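import Summits.QuantumFields.BalabanUV.T4Continuum.Support.B13StepTermShift

/-!
# NE5 ∕ U3, crux O1, row O1-d1 follower (iii-b) — `B13StepTermTranslate`: the ACTION of the translations of `π_k` ON THE TERM LABELS
# of the (2.13)∘(2.9)∘Σ_{𝐃,P}(2.14) expansion, the INVARIANCE of `ρᵀ` ∕ the coefficient ∕ the tree lengths, and the COVARIANCE OF
# LOCALIZATION in the meaningful range of scales (part 2 of 3 of the anchored coding of record, design v0.3 R9)

Cell `pub-balaban`, unit `b2b-balaban-t4-ne5-formalise-leaf-02` (NE5 formalisation swarm, leaf prover 02 — holder lineage of row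
O1-d1 of `t4/b2b-balaban-t4-ne5-p1/O1-CLAIM-TABLE-NE5-P1.md` v1.3; journal INTENT l.8957; design `B13StepDesign.md` v0.3 RULING R9
«anchored term labels»).  Summits-side NEW WORK under the LEAN PLACEMENT RULE (cell modelling + kernel-checked bookkeeping on the swarm's
objects of record; nothing of the manuscripts under audit is asserted — [II] = [Balaban1988RG2Cluster] and [Balaban1987RG1] are cited
for KIND∕locus only).
HONEST FRAMING: rung (B)+1 bookkeeping for the FINITE-VOLUME T⁴ programme — NOT the continuum limit by itself, NOT infinite
volume, NOT a mass gap, NOT Clay; NE5 NOT PROVED; spine 0∕9.  HONEST DEPENDENCY (cell line, verbatim): continuum YM on T⁴ ⇐ BetaPertH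
∧ nine spine estimates (0/9 proved); BetaPertH ⇐ (D1) ∧ (D4) ∧ CAP+tail; G-an2-4 gates asym, D1 and NE2/3/4.

WHAT IS PROVED (kernel-checked; every `def` is data; imports part 1 `B13StepTermShift` BY NAME; `G := B13DomainGeometryTR.domainGeometry R`,
`D := B13InnerData.b13InnerData R` — the geometry and inner data OF RECORD).
* §1 the action on labels: `InnerLabel.translate` ∕ `PolyLabel.translate` ∕ `translateTuple` ∕ **`TermIdx.translate R k v`** (every
  polymer, conditioning domain, Mayer subfamily and bond set moved by the translation its own level sees) — a GROUP ACTION of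
  `(ℤ∕N_k)⁴` (`translate_zero`, `translate_add`), hence **`TermIdx.translate_injective`** with inverse `translate (−v)` (the permutation `TermIdx.translateEquiv`),
  NO range hypothesis.  INVARIANTS with no range hypothesis: `touchRel_translateAt_iff`, **`rhoT_translateAt`**∕**`rhoT_translate`** (the Ursell
  coefficient `ρᵀ(Z₁,…,Zₙ)` of [II] (2.12) only sees the touching graph — the tree's relabelling invariance `hcUrsell_map` along the
  identity), `coeff_translate`, `d_polys_translate`.
* §2 COVARIANCE (output scale in the meaningful range `k + m′ ≤ m + K`): `within_translateAt_iff` (leaf-02's cross-level inclusion, via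
  `coarsen_add_liftVec`), `mk_mem_bondsIn_iff`∕`mem_bondsIn_translate_iff` (the interior bond sets, via `toCube_add_siteVec`),
  `innerWF_translate_iff`, `polyWF_translate_iff`, `covers_translate_iff` (the constraint `∪ Zᵢ = X` of (2.13) — no range needed), and
  **`localizesAt_translate_iff : (t.translate k v).LocalizesAt G D k (translateAt k v X) ↔ t.LocalizesAt G D k X`**; as finite catalogues
  **`termLabels_translateAt`** (`termLabels G D k (translateAt k v X) n = (termLabels G D k X n).map ⟨translateTuple k v, _⟩`) and
  `card_termLabels_translateAt`; `scale_eq_of_localizesAt` (a localizing label forces `scale X = k`).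
HONEST SIDE CONDITION: cross-level covariance carries `k + m′ ≤ m + K` (output scale in the meaningful range of `B13Carriers`; on junk
scales `N_{k−1} = L·N_k` fails); injectivity and the invariants carry nothing.  NOT an estimate; no END face or consumer touched.
0 sorry; axioms ⊆ {propext, Classical.choice, Quot.sound}.
-/

noncomputable section

namespace Summit.QuantumFields.BalabanUV.T4Continuum.B13StepTermTranslate

open scoped BigOperators
open Literature.MathematicalPhysics.QuantumFieldTheory.Balaban1983to89
open Literature.Probability.LatticeModels (hcUrsell hcUrsell_map)
open Literature.MathematicalPhysics.QuantumFieldTheory.Balaban1983to89.TreeLengthTorus (TPt TDom TAdj torusTreeLen)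
open Summit.QuantumFields.BalabanUV.T4Continuum.B13Carriers (TwoRuns)
open Summit.QuantumFields.BalabanUV.T4Continuum.B13CarriersTranslation (mem_image_add_iff)
open Summit.QuantumFields.BalabanUV.T4Continuum.B13CarriersFootprint (toCube toCube_apply sitesAt mem_sitesAt)
open Summit.QuantumFields.BalabanUV.T4Continuum.B13InnerData (Bnd coarsen coarsen_apply b13InnerData Within innerLevel bondsIn
  mem_innerLevel mem_bondsIn)
open Summit.QuantumFields.BalabanUV.T4Continuum.B13StepTermLabels (InnerLabel PolyLabel TermIdx Covers termLabels mem_termLabels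
  touchRel rhoT coeff)
open Summit.QuantumFields.BalabanUV.T4Continuum.B13DomainGeometryTR (SCube footprint touch domainGeometry fst_eq_of_mem_footprint
  footprint_nonempty)
open Summit.QuantumFields.BalabanUV.T4Continuum.B13StepTermShift

variable {G : Type} [GaugeGroup G] {R : TwoRuns G}

/-! ## §1 The action on term labels; invariants -/

section Action
/-- [folklore] THE INDUCED TRANSLATION OF AN INNER LABEL `(Z₀, 𝐃, P)`. -/
def InnerLabel.translate (k : ℕ) (v : TPt 4 (R.cubesPerDir k)) (ℓ : InnerLabel R.carriers.Dom (Bnd R)) :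
    InnerLabel R.carriers.Dom (Bnd R) :=
  ⟨translateAt k v ℓ.Z₀, ℓ.fam.image (translateAt k v), ℓ.P.image (bondTranslate k v)⟩

/-- [folklore] THE INDUCED TRANSLATION OF A FACTOR LABEL `(Z; Z₀, 𝐃, P)`. -/
def PolyLabel.translate (k : ℕ) (v : TPt 4 (R.cubesPerDir k)) (p : PolyLabel R.carriers.Dom (Bnd R)) :
    PolyLabel R.carriers.Dom (Bnd R) :=
  ⟨translateAt k v p.Z, InnerLabel.translate k v p.inner⟩

/-- [folklore] The induced translation of a tuple of factor labels. -/
def translateTuple (k : ℕ) (v : TPt 4 (R.cubesPerDir k)) {n : ℕ} (p : Fin (n + 1) → PolyLabel R.carriers.Dom (Bnd R)) :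
    Fin (n + 1) → PolyLabel R.carriers.Dom (Bnd R) :=
  fun i => PolyLabel.translate k v (p i)

/-- [folklore] **THE INDUCED TRANSLATION OF A TERM LABEL** of (2.13)∘(2.9)∘Σ_{𝐃,P}(2.14): every polymer, conditioning domain, Mayer
subfamily and bond set moved by the translation its own level sees. -/
def TermIdx.translate (k : ℕ) (v : TPt 4 (R.cubesPerDir k)) (t : TermIdx R.carriers.Dom (Bnd R)) :
    TermIdx R.carriers.Dom (Bnd R) :=
  ⟨t.1, translateTuple k v t.2⟩

/-- [folklore] The number of factors is kept (definitional). -/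
@[simp] theorem TermIdx.translate_fst (k : ℕ) (v : TPt 4 (R.cubesPerDir k)) (t : TermIdx R.carriers.Dom (Bnd R)) :
    (TermIdx.translate k v t).1 = t.1 := rfl

/-- [folklore] The polymer tuple of a translated label is the translated polymer tuple (definitional). -/
theorem TermIdx.polys_translate (k : ℕ) (v : TPt 4 (R.cubesPerDir k)) (t : TermIdx R.carriers.Dom (Bnd R)) :
    (TermIdx.translate k v t).polys = fun i => translateAt k v (t.polys i) := rfl

/-- [folklore] ACTION on inner labels, unit. -/
@[simp] theorem InnerLabel.translate_zero (k : ℕ) (ℓ : InnerLabel R.carriers.Dom (Bnd R)) :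
    InnerLabel.translate k (0 : TPt 4 (R.cubesPerDir k)) ℓ = ℓ := by
  obtain ⟨Z₀, fam, P⟩ := ℓ
  have h1 : translateAt (R := R) k (0 : TPt 4 (R.cubesPerDir k)) = id := funext (translateAt_zero k)
  have h2 : bondTranslate (R := R) k (0 : TPt 4 (R.cubesPerDir k)) = id := funext (bondTranslate_zero k)
  simp only [InnerLabel.translate, h1, h2, Finset.image_id, id]

/-- [folklore] ACTION on inner labels, multiplication. -/
theorem InnerLabel.translate_add (k : ℕ) (v w : TPt 4 (R.cubesPerDir k)) (ℓ : InnerLabel R.carriers.Dom (Bnd R)) :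
    InnerLabel.translate k (v + w) ℓ = InnerLabel.translate k w (InnerLabel.translate k v ℓ) := by
  obtain ⟨Z₀, fam, P⟩ := ℓ
  have h1 : translateAt (R := R) k (v + w) = translateAt k w ∘ translateAt k v := funext (translateAt_add k v w)
  have h2 : bondTranslate (R := R) k (v + w) = bondTranslate k w ∘ bondTranslate k v := funext (bondTranslate_add k v w)
  simp only [InnerLabel.translate, Finset.image_image, h1, h2, Function.comp_apply]

/-- [folklore] ACTION on factor labels, unit. -/
@[simp] theorem PolyLabel.translate_zero (k : ℕ) (p : PolyLabel R.carriers.Dom (Bnd R)) :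
    PolyLabel.translate k (0 : TPt 4 (R.cubesPerDir k)) p = p := by
  obtain ⟨Z, ℓ⟩ := p
  simp only [PolyLabel.translate, translateAt_zero, InnerLabel.translate_zero]

/-- [folklore] ACTION on factor labels, multiplication. -/
theorem PolyLabel.translate_add (k : ℕ) (v w : TPt 4 (R.cubesPerDir k)) (p : PolyLabel R.carriers.Dom (Bnd R)) :
    PolyLabel.translate k (v + w) p = PolyLabel.translate k w (PolyLabel.translate k v p) := by
  obtain ⟨Z, ℓ⟩ := p
  simp only [PolyLabel.translate, translateAt_add, InnerLabel.translate_add]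

/-- [folklore] ACTION on tuples, unit. -/
@[simp] theorem translateTuple_zero (k : ℕ) {n : ℕ} (p : Fin (n + 1) → PolyLabel R.carriers.Dom (Bnd R)) :
    translateTuple k (0 : TPt 4 (R.cubesPerDir k)) p = p := by
  funext i; simp only [translateTuple, PolyLabel.translate_zero]

/-- [folklore] ACTION on tuples, multiplication. -/
theorem translateTuple_add (k : ℕ) (v w : TPt 4 (R.cubesPerDir k)) {n : ℕ} (p : Fin (n + 1) → PolyLabel R.carriers.Dom (Bnd R)) :
    translateTuple k (v + w) p = translateTuple k w (translateTuple k v p) := by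
  funext i; simp only [translateTuple, PolyLabel.translate_add]

/-- [folklore] Tuple translation by a fixed vector is injective. -/
theorem translateTuple_injective (k : ℕ) (v : TPt 4 (R.cubesPerDir k)) {n : ℕ} :
    Function.Injective (translateTuple (R := R) k v (n := n)) := by
  intro p p' h
  have h' := congrArg (translateTuple k (-v)) h
  rwa [← translateTuple_add, ← translateTuple_add, add_neg_cancel, translateTuple_zero, translateTuple_zero] at h'

/-- [folklore] **ACTION ON TERM LABELS, unit**: `translate k 0 = id`. -/
@[simp] theorem TermIdx.translate_zero (k : ℕ) (t : TermIdx R.carriers.Dom (Bnd R)) :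
    TermIdx.translate k (0 : TPt 4 (R.cubesPerDir k)) t = t := by
  obtain ⟨n, p⟩ := t
  simp only [TermIdx.translate, translateTuple_zero]

/-- [folklore] **ACTION ON TERM LABELS, multiplication**: `translate k (v + w) = translate k w ∘ translate k v`. -/
theorem TermIdx.translate_add (k : ℕ) (v w : TPt 4 (R.cubesPerDir k)) (t : TermIdx R.carriers.Dom (Bnd R)) :
    TermIdx.translate k (v + w) t = TermIdx.translate k w (TermIdx.translate k v t) := by
  obtain ⟨n, p⟩ := t
  simp only [TermIdx.translate, translateTuple_add]

/-- [folklore] **TRANSLATION OF TERM LABELS BY A FIXED VECTOR IS INJECTIVE** (inverse `translate k (−v)`; NO range hypothesis). -/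
theorem TermIdx.translate_injective (k : ℕ) (v : TPt 4 (R.cubesPerDir k)) :
    Function.Injective (TermIdx.translate (R := R) k v) := by
  intro t t' h
  have h' := congrArg (TermIdx.translate k (-v)) h
  rwa [← TermIdx.translate_add, ← TermIdx.translate_add, add_neg_cancel, TermIdx.translate_zero,
    TermIdx.translate_zero] at h'

/-- [folklore] The inverse translation undoes the translation. -/
theorem TermIdx.translate_neg_translate (k : ℕ) (v : TPt 4 (R.cubesPerDir k)) (t : TermIdx R.carriers.Dom (Bnd R)) :
    TermIdx.translate k (-v) (TermIdx.translate k v t) = t := by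
  rw [← TermIdx.translate_add, add_neg_cancel, TermIdx.translate_zero]

/-- [folklore] … and conversely. -/
theorem TermIdx.translate_translate_neg (k : ℕ) (v : TPt 4 (R.cubesPerDir k)) (t : TermIdx R.carriers.Dom (Bnd R)) :
    TermIdx.translate k v (TermIdx.translate k (-v) t) = t := by
  rw [← TermIdx.translate_add, neg_add_cancel, TermIdx.translate_zero]

/-- [folklore] **TRANSLATION BY `v` IS A PERMUTATION OF THE TERM LABELS** (inverse: translation by `−v`), packaged as an
`Equiv` (for re-indexing sums over labels, `Equiv.tsum_eq`). -/
def TermIdx.translateEquiv (k : ℕ) (v : TPt 4 (R.cubesPerDir k)) :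
    TermIdx R.carriers.Dom (Bnd R) ≃ TermIdx R.carriers.Dom (Bnd R) where
  toFun := TermIdx.translate k v
  invFun := TermIdx.translate k (-v)
  left_inv := TermIdx.translate_neg_translate k v
  right_inv := TermIdx.translate_translate_neg k v

/-- [folklore] The permutation is the translation (definitional). -/
@[simp] theorem TermIdx.translateEquiv_apply (k : ℕ) (v : TPt 4 (R.cubesPerDir k)) (t : TermIdx R.carriers.Dom (Bnd R)) :
    TermIdx.translateEquiv k v t = TermIdx.translate k v t := rfl

/-! ### Invariants with no range hypothesis: `ρᵀ`, the coefficient, the tree lengths -/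

/-- [folklore] THE TOUCHING RELATION ON THE INDICES OF A POLYMER TUPLE IS TRANSLATION INVARIANT. -/
theorem touchRel_translateAt_iff (k : ℕ) (v : TPt 4 (R.cubesPerDir k)) {n : ℕ} (Z : Fin (n + 1) → R.carriers.Dom)
    (a b : Fin (n + 1)) :
    touchRel (domainGeometry R) (fun i => translateAt k v (Z i)) a b ↔ touchRel (domainGeometry R) Z a b := by
  show touch (footprint (translateAt k v (Z a))) (footprint (translateAt k v (Z b))) ↔ touch (footprint (Z a)) (footprint (Z b))
  rw [footprint_translateAt, footprint_translateAt, touch_image_iff]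

/-- [folklore] **THE URSELL COEFFICIENT `ρᵀ(Z₁,…,Zₙ)` OF (2.12) IS TRANSLATION INVARIANT** (it only sees the touching graph; the
tree's relabelling invariance `hcUrsell_map` along the identity). -/
theorem rhoT_translateAt (k : ℕ) (v : TPt 4 (R.cubesPerDir k)) {n : ℕ} (Z : Fin (n + 1) → R.carriers.Dom) :
    rhoT (domainGeometry R) (fun i => translateAt k v (Z i)) = rhoT (domainGeometry R) Z := by
  have h := hcUrsell_map (Equiv.refl (Fin (n + 1))).toEmbedding (H := touchRel (domainGeometry R) Z)
    (H' := touchRel (domainGeometry R) (fun i => translateAt k v (Z i))) (fun a b => touchRel_translateAt_iff k v Z a b)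
    Finset.univ
  rw [Finset.map_univ_equiv] at h
  exact h

/-- [folklore] `ρᵀ` of a translated term label is `ρᵀ` of the label. -/
theorem rhoT_translate (k : ℕ) (v : TPt 4 (R.cubesPerDir k)) (t : TermIdx R.carriers.Dom (Bnd R)) :
    rhoT (domainGeometry R) (TermIdx.translate k v t).polys = rhoT (domainGeometry R) t.polys :=
  rhoT_translateAt k v t.polys

/-- [folklore] THE COEFFICIENT `ρᵀ/(n+1)!` OF A TERM LABEL IS TRANSLATION INVARIANT. -/
theorem coeff_translate (k : ℕ) (v : TPt 4 (R.cubesPerDir k)) (t : TermIdx R.carriers.Dom (Bnd R)) :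
    coeff (domainGeometry R) (TermIdx.translate k v t) = coeff (domainGeometry R) t := by
  show (rhoT (domainGeometry R) (fun i => translateAt k v (t.polys i)) : ℝ) / ((t.1 + 1).factorial : ℕ) =
    (rhoT (domainGeometry R) t.polys : ℝ) / ((t.1 + 1).factorial : ℕ)
  rw [rhoT_translateAt]

/-- [folklore] THE TREE LENGTHS OF THE POLYMERS OF A TERM LABEL ARE TRANSLATION INVARIANT. -/
theorem d_polys_translate (k : ℕ) (v : TPt 4 (R.cubesPerDir k)) (t : TermIdx R.carriers.Dom (Bnd R)) (i : Fin (t.1 + 1)) :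
    R.carriers.d ((TermIdx.translate k v t).polys i) = R.carriers.d (t.polys i) :=
  d_translateAt k v _

end Action

/-! ## §2 Covariance of localization (output scale in the meaningful range `k + m′ ≤ m + K`) -/

section Covariance

/-- [folklore] Membership in the catalogue `𝐃_j` is translation invariant (the scale is kept). -/
theorem mem_domAt_translateAt_iff (k : ℕ) (v : TPt 4 (R.cubesPerDir k)) {j : ℕ} (Y : R.carriers.Dom) :
    translateAt k v Y ∈ R.domAt j ↔ Y ∈ R.domAt j := by
  rw [TwoRuns.mem_domAt, TwoRuns.mem_domAt]; exact Iff.rfl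

/-- [folklore] Membership in the inner catalogue `𝐃_{j−1}` is translation invariant. -/
theorem mem_innerLevel_translateAt_iff (k : ℕ) (v : TPt 4 (R.cubesPerDir k)) {j : ℕ} (Y : R.carriers.Dom) :
    translateAt k v Y ∈ innerLevel R j ↔ Y ∈ innerLevel R j := by
  rw [mem_innerLevel, mem_innerLevel]; exact Iff.rfl

/-- [folklore] A translated cube lies in the translated family iff the cube lies in the family. -/
theorem add_mem_image_add_iff {M : ℕ} {S : Finset (TPt 4 M)} {a u : TPt 4 M} : a + u ∈ S.image (· + u) ↔ a ∈ S := by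
  rw [mem_image_add_iff, add_sub_cancel_right]

/-- [folklore] **CROSS-LEVEL INCLUSION IS TRANSLATION COVARIANT** in range: for `scale Z ≤ k` and `k + m′ ≤ m + K`,
`Within (τY) (τZ) ↔ Within Y Z` (leaf-02's `B13InnerData.Within`: the cubes of `Y` coarsened to `Z`'s level lie in `Z` —
`coarsen_add_liftVec`). -/
theorem within_translateAt_iff {k : ℕ} {Y Z : R.carriers.Dom} (hZk : Z.1 ≤ k) (hk : k + R.m' ≤ R.F.m + R.K)
    (v : TPt 4 (R.cubesPerDir k)) : Within R (translateAt k v Y) (translateAt k v Z) ↔ Within R Y Z := by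
  obtain ⟨i, Y⟩ := Y
  obtain ⟨j, Z⟩ := Z
  by_cases hij : i ≤ j
  · have hcomm : (coarsen R i j) ∘ (· + liftVec R k i v) = (· + liftVec R k j v) ∘ coarsen R i j :=
      funext fun a => coarsen_add_liftVec R hij hZk hk a v
    show i ≤ j ∧ (Y.1.image (· + liftVec R k i v)).image (coarsen R i j) ⊆ Z.1.image (· + liftVec R k j v) ↔
      i ≤ j ∧ Y.1.image (coarsen R i j) ⊆ Z.1
    rw [Finset.image_image, hcomm, ← Finset.image_image]
    exact and_congr Iff.rfl (Finset.image_subset_image_iff (add_left_injective _))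
  · constructor
    · rintro ⟨h, -⟩; exact absurd h hij
    · rintro ⟨h, -⟩; exact absurd h hij

/-- [folklore] Membership in `bondsIn ⟨j, Z⟩`, fibrewise: a bond of level `i` lies inside iff `i = j` and the `M`-cubes of both its
endpoints are cubes of `Z`. -/
theorem mk_mem_bondsIn_iff {j : ℕ} (Z : TDom 4 (R.cubesPerDir j)) {i : ℕ} (c : PBond (R.F.P R.K) i) :
    (⟨i, c⟩ : Bnd R) ∈ bondsIn R ⟨j, Z⟩ ↔ ∃ _ : i = j, toCube R i j c.src ∈ Z.1 ∧ toCube R i j c.tgt ∈ Z.1 := by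
  rw [mem_bondsIn]
  constructor
  · rintro ⟨c', hb, hs, ht⟩
    obtain ⟨rfl, hcc⟩ := Sigma.mk.inj_iff.1 hb
    have hcc' : c = c' := eq_of_heq hcc
    subst hcc'
    exact ⟨rfl, (mem_sitesAt _ _).1 hs, (mem_sitesAt _ _).1 ht⟩
  · rintro ⟨rfl, hs, ht⟩
    exact ⟨c, rfl, (mem_sitesAt _ _).2 hs, (mem_sitesAt _ _).2 ht⟩

/-- [folklore] **THE INTERIOR BOND SETS ARE TRANSLATION COVARIANT** in range: for `scale Z₀ ≤ k` and `k + m′ ≤ m + K`, a translated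
bond lies inside the translated `Z₀` iff the bond lies inside `Z₀` (`toCube_add_siteVec`). -/
theorem mem_bondsIn_translate_iff {k : ℕ} {Z₀ : R.carriers.Dom} (hZk : Z₀.1 ≤ k) (hk : k + R.m' ≤ R.F.m + R.K)
    (v : TPt 4 (R.cubesPerDir k)) (b : Bnd R) :
    bondTranslate k v b ∈ bondsIn R (translateAt k v Z₀) ↔ b ∈ bondsIn R Z₀ := by
  obtain ⟨j, Z⟩ := Z₀
  obtain ⟨i, c⟩ := b
  obtain ⟨src, dir⟩ := c
  simp only [bondTranslate, translateAt, B13CarriersTranslation.Dom.translate]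
  rw [mk_mem_bondsIn_iff, mk_mem_bondsIn_iff]
  refine exists_congr fun hij => ?_
  subst hij
  simp only [PBond.tgt, B13CarriersTranslation.TDom.translate_val, shift_add R src (siteVec R k i v) dir]
  rw [toCube_add_siteVec R (Nat.le_add_right i R.m') hZk hk, toCube_add_siteVec R (Nat.le_add_right i R.m') hZk hk,
    add_mem_image_add_iff, add_mem_image_add_iff]

/-- [folklore] **WELL-FORMEDNESS OF AN INNER LABEL IS TRANSLATION COVARIANT** in range (`scale Z ≤ k`, `k + m′ ≤ m + K`). -/
theorem innerWF_translate_iff {k : ℕ} {Z : R.carriers.Dom} (hZk : Z.1 ≤ k) (hk : k + R.m' ≤ R.F.m + R.K)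
    (v : TPt 4 (R.cubesPerDir k)) (ℓ : InnerLabel R.carriers.Dom (Bnd R)) :
    (InnerLabel.translate k v ℓ).WF (b13InnerData R) k (translateAt k v Z) ↔ ℓ.WF (b13InnerData R) k Z := by
  constructor
  · rintro ⟨h0, h1, h2, h3, h4⟩
    have hZ₀ : ℓ.Z₀.1 ≤ k := by
      have := ((mem_innerLevel R).1 h0).2
      simp only [InnerLabel.translate, TwoRuns.carriers_scale, translateAt_fst] at this
      omega
    refine ⟨(mem_innerLevel_translateAt_iff k v ℓ.Z₀).1 h0, fun Y hY => ?_, fun Y hY => ?_, fun b hb => ?_,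
      (within_translateAt_iff hZk hk v).1 h4⟩
    · exact (mem_innerLevel_translateAt_iff k v Y).1 (h1 (Finset.mem_image_of_mem _ hY))
    · exact (within_translateAt_iff hZ₀ hk v).1 (h2 _ (Finset.mem_image_of_mem _ hY))
    · exact (mem_bondsIn_translate_iff hZ₀ hk v b).1 (h3 (Finset.mem_image_of_mem _ hb))
  · rintro ⟨h0, h1, h2, h3, h4⟩
    have hZ₀ : ℓ.Z₀.1 ≤ k := by
      have := ((mem_innerLevel R).1 h0).2
      simp only [TwoRuns.carriers_scale] at this
      omega
    refine ⟨(mem_innerLevel_translateAt_iff k v ℓ.Z₀).2 h0, fun Y' hY' => ?_, fun Y' hY' => ?_, fun b' hb' => ?_,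
      (within_translateAt_iff hZk hk v).2 h4⟩
    · obtain ⟨Y, hY, rfl⟩ := Finset.mem_image.1 hY'
      exact (mem_innerLevel_translateAt_iff k v Y).2 (h1 hY)
    · obtain ⟨Y, hY, rfl⟩ := Finset.mem_image.1 hY'
      exact (within_translateAt_iff hZ₀ hk v).2 (h2 Y hY)
    · obtain ⟨b, hb, rfl⟩ := Finset.mem_image.1 hb'
      exact (mem_bondsIn_translate_iff hZ₀ hk v b).2 (h3 hb)

/-- [folklore] **WELL-FORMEDNESS OF A FACTOR LABEL IS TRANSLATION COVARIANT** (output scale `k` in range). -/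
theorem polyWF_translate_iff {k : ℕ} (hk : k + R.m' ≤ R.F.m + R.K) (v : TPt 4 (R.cubesPerDir k)) (X : R.carriers.Dom)
    (p : PolyLabel R.carriers.Dom (Bnd R)) :
    (PolyLabel.translate k v p).WF (domainGeometry R) (b13InnerData R) k (translateAt k v X) ↔
      p.WF (domainGeometry R) (b13InnerData R) k X := by
  constructor
  · rintro ⟨hZ, hsub, hin⟩
    have hZ' : p.Z ∈ R.domAt k := (mem_domAt_translateAt_iff k v p.Z).1 hZ
    have hZk : p.Z.1 ≤ k := (R.mem_domAt.1 hZ').le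
    exact ⟨hZ', (footprint_subset_translateAt_iff k v p.Z X).1 hsub, (innerWF_translate_iff hZk hk v p.inner).1 hin⟩
  · rintro ⟨hZ, hsub, hin⟩
    have hZk : p.Z.1 ≤ k := (R.mem_domAt.1 hZ).le
    exact ⟨(mem_domAt_translateAt_iff k v p.Z).2 hZ, (footprint_subset_translateAt_iff k v p.Z X).2 hsub,
      (innerWF_translate_iff hZk hk v p.inner).2 hin⟩

/-- [folklore] **THE COVERING CONSTRAINT `∪ Zᵢ = X` OF (2.13) IS TRANSLATION INVARIANT** (no range hypothesis). -/
theorem covers_translate_iff (k : ℕ) (v : TPt 4 (R.cubesPerDir k)) (X : R.carriers.Dom) {n : ℕ}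
    (Z : Fin (n + 1) → R.carriers.Dom) :
    Covers (domainGeometry R) (translateAt k v X) (fun i => translateAt k v (Z i)) ↔ Covers (domainGeometry R) X Z := by
  show (Finset.univ.biUnion fun i => footprint (translateAt k v (Z i))) = footprint (translateAt k v X) ↔
    (Finset.univ.biUnion fun i => footprint (Z i)) = footprint X
  simp only [footprint_translateAt]
  rw [← Finset.biUnion_image]
  exact (Finset.image_injective (cubeTranslate_injective k v)).eq_iff

/-- [folklore] **LOCALIZATION OF A TERM LABEL IS TRANSLATION COVARIANT** (output scale `k` in the meaningful range
`k + m′ ≤ m + K`): `t` localizes at `X` at step `k` iff its translate localizes at the translate of `X`.  This is the kernel content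
of design v0.3 R9 «term labels of record are shapes relative to `X`». -/
theorem localizesAt_translate_iff {k : ℕ} (hk : k + R.m' ≤ R.F.m + R.K) (v : TPt 4 (R.cubesPerDir k)) (X : R.carriers.Dom)
    (t : TermIdx R.carriers.Dom (Bnd R)) :
    (TermIdx.translate k v t).LocalizesAt (domainGeometry R) (b13InnerData R) k (translateAt k v X) ↔
      t.LocalizesAt (domainGeometry R) (b13InnerData R) k X :=
  and_congr (forall_congr' fun i => polyWF_translate_iff hk v X (t.2 i)) (covers_translate_iff k v X t.polys)

/-- [folklore] **THE FINITE CATALOGUES ARE TRANSLATION COVARIANT**: the term labels with `n + 1` factors localizing at the translate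
of `X` are exactly the translates of those localizing at `X`. -/
theorem termLabels_translateAt {k : ℕ} (hk : k + R.m' ≤ R.F.m + R.K) (v : TPt 4 (R.cubesPerDir k)) (X : R.carriers.Dom)
    (n : ℕ) :
    termLabels (domainGeometry R) (b13InnerData R) k (translateAt k v X) n =
      (termLabels (domainGeometry R) (b13InnerData R) k X n).map ⟨translateTuple k v, translateTuple_injective k v⟩ := by
  ext p'
  simp only [Finset.mem_map, Function.Embedding.coeFn_mk, mem_termLabels]
  constructor
  · intro hp'
    refine ⟨translateTuple k (-v) p', ?_, ?_⟩
    · have h := (localizesAt_translate_iff hk v X ⟨n, translateTuple k (-v) p'⟩).1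
      rw [TermIdx.translate, ← translateTuple_add, neg_add_cancel, translateTuple_zero] at h
      exact h hp'
    · rw [← translateTuple_add, neg_add_cancel, translateTuple_zero]
  · rintro ⟨p, hp, rfl⟩
    exact (localizesAt_translate_iff hk v X ⟨n, p⟩).2 hp

/-- [folklore] THE CATALOGUE SIZES ARE TRANSLATION INVARIANTS (shape invariants of `X`). -/
theorem card_termLabels_translateAt {k : ℕ} (hk : k + R.m' ≤ R.F.m + R.K) (v : TPt 4 (R.cubesPerDir k)) (X : R.carriers.Dom)
    (n : ℕ) :
    (termLabels (domainGeometry R) (b13InnerData R) k (translateAt k v X) n).card =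
      (termLabels (domainGeometry R) (b13InnerData R) k X n).card := by
  rw [termLabels_translateAt hk, Finset.card_map]

/-- [folklore] A label localizing at `X` at step `k` forces `scale X = k` (its first polymer is a scale-`k` domain whose footprint
lies in that of `X`, and footprints of different scales are disjoint). -/
theorem scale_eq_of_localizesAt {k : ℕ} {X : R.carriers.Dom} {t : TermIdx R.carriers.Dom (Bnd R)}
    (ht : t.LocalizesAt (domainGeometry R) (b13InnerData R) k X) : R.carriers.scale X = k := by
  obtain ⟨hZ, hsub, -⟩ := ht.1 0
  have hZk : (t.2 0).Z.1 = k := R.mem_domAt.1 hZ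
  obtain ⟨c, hc⟩ := footprint_nonempty (t.2 0).Z
  rw [TwoRuns.carriers_scale, ← hZk, ← fst_eq_of_mem_footprint hc, fst_eq_of_mem_footprint (hsub hc)]

end Covariance

end Summit.QuantumFields.BalabanUV.T4Continuum.B13StepTermTranslate

end
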